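import Mathlib.Analysis.Convex.Function
import Mathlib.Analysis.SpecialFunctions.Pow.Real
import Mathlib.Algebra.BigOperators.Fin

/-!
# Near-certificate layer V2: the vertex interpolation lemma (lead c2, vertex scheme)

Support file for crux `PhononStability` (stmt-AtomisticToContinuum-9333), line `contragredient-window-collapse`.

The analytic core of the vertex scheme.  ONE DIMENSION (`ge_chord_sub`): if `t ↦ g t − (M/2) t²` is concave
on `[a, b]`, then `g` lies above its chord minus `(M/2)(t − a)(b − t) ≤ (M/2)((b − a)/2)²`.  SEVERAL DIMENSIONS
(`ge_min_vertices_sub`): on a box `Π [cᵢ − hᵢ, cᵢ + hᵢ]`, if every coordinate slice of `f` through every point of the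
box has this property with constant `Mᵢ ≥ 0`, then `f x ≥ m − Σᵢ Mᵢ hᵢ²/2` whenever `m ≤ f` at the `2ⁿ` vertices
(induction over the set of coordinates that are not yet at an endpoint).  Coordinate slices on which `f` is concave
cost nothing (`Mᵢ = 0`); multi-affine parts of `f` cost nothing in every direction.
-/

noncomputable section

open scoped BigOperators Classical

namespace Summit.AtomisticToContinuum.Crystallization.Theorems.PhononStabilityCWC.Cert

/-! ## One dimension -/

/-- the chord of `g` over `[a, b]` -/
def chord (g : ℝ → ℝ) (a b t : ℝ) : ℝ := ((b - t) * g a + (t - a) * g b) / (b - a)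

/-- **concavity of `g − (M/2)t²` puts `g` above its chord minus `(M/2)(t−a)(b−t)`.** [folklore] -/
theorem ge_chord_sub {g : ℝ → ℝ} {a b M : ℝ} (hab : a < b)
    (hconc : ConcaveOn ℝ (Set.Icc a b) (fun t => g t - M / 2 * t ^ 2)) {t : ℝ} (ht : t ∈ Set.Icc a b) :
    chord g a b t - M / 2 * ((t - a) * (b - t)) ≤ g t := by
  obtain ⟨hta, htb⟩ := ht
  have hba : 0 < b - a := sub_pos.mpr hab
  set lam := (b - t) / (b - a) with hlam
  set mu := (t - a) / (b - a) with hmu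
  have hlam0 : 0 ≤ lam := div_nonneg (by linarith) hba.le
  have hmu0 : 0 ≤ mu := div_nonneg (by linarith) hba.le
  have hsum : lam + mu = 1 := by
    rw [hlam, hmu, ← add_div]; rw [show b - t + (t - a) = b - a by ring]; exact div_self hba.ne'
  have hcomb : lam * a + mu * b = t := by
    rw [hlam, hmu]; field_simp; ring
  have ha : a ∈ Set.Icc a b := ⟨le_rfl, hab.le⟩
  have hb : b ∈ Set.Icc a b := ⟨hab.le, le_rfl⟩
  have key := hconc.2 ha hb hlam0 hmu0 hsum
  simp only [smul_eq_mul] at key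
  rw [hcomb] at key
  -- key : lam * (g a - M/2 a²) + mu * (g b - M/2 b²) ≤ g t - M/2 t²
  have hchord : chord g a b t = lam * g a + mu * g b := by
    unfold chord; rw [hlam, hmu]; field_simp
  have hid : lam * a ^ 2 + mu * b ^ 2 - t ^ 2 = (t - a) * (b - t) := by
    rw [hlam, hmu]; field_simp; ring
  rw [hchord]
  have hid2 : M / 2 * (lam * a ^ 2 + mu * b ^ 2 - t ^ 2) = M / 2 * ((t - a) * (b - t)) := by rw [hid]
  linarith [key, hid2]

/-- the chord lies above the smaller endpoint value. [folklore] -/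
theorem min_le_chord (g : ℝ → ℝ) {a b t : ℝ} (hab : a < b) (ht : t ∈ Set.Icc a b) :
    min (g a) (g b) ≤ chord g a b t := by
  obtain ⟨hta, htb⟩ := ht
  have hba : 0 < b - a := sub_pos.mpr hab
  unfold chord
  rw [le_div_iff₀ hba]
  have h1 : min (g a) (g b) ≤ g a := min_le_left _ _
  have h2 : min (g a) (g b) ≤ g b := min_le_right _ _
  nlinarith

/-- **one-dimensional vertex bound:** `g t ≥ min (g a) (g b) − (M/2)·((b−a)/2)²` for `M ≥ 0`. [folklore] -/
theorem ge_min_sub {g : ℝ → ℝ} {a b M : ℝ} (hab : a < b) (hM : 0 ≤ M)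
    (hconc : ConcaveOn ℝ (Set.Icc a b) (fun t => g t - M / 2 * t ^ 2)) {t : ℝ} (ht : t ∈ Set.Icc a b) :
    min (g a) (g b) - M / 2 * ((b - a) / 2) ^ 2 ≤ g t := by
  have h1 := ge_chord_sub hab hconc ht
  have h2 := min_le_chord g hab ht
  obtain ⟨hta, htb⟩ := ht
  have h3 : (t - a) * (b - t) ≤ ((b - a) / 2) ^ 2 := by nlinarith [sq_nonneg (t - (a + b) / 2)]
  have h4 : M / 2 * ((t - a) * (b - t)) ≤ M / 2 * ((b - a) / 2) ^ 2 :=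
    mul_le_mul_of_nonneg_left h3 (by linarith)
  linarith

/-! ## Several dimensions -/

variable {n : ℕ}

/-- the closed box `Π [cᵢ − hᵢ, cᵢ + hᵢ]` -/
def box (c h : Fin n → ℝ) : Set (Fin n → ℝ) := {x | ∀ i, c i - h i ≤ x i ∧ x i ≤ c i + h i}

/-- the vertices of the box -/
def IsVertex (c h : Fin n → ℝ) (x : Fin n → ℝ) : Prop := ∀ i, x i = c i - h i ∨ x i = c i + h i

/-- a vertex lies in the box (for nonnegative half-widths). [folklore] -/
theorem mem_box_of_isVertex {c h : Fin n → ℝ} (hh : ∀ i, 0 ≤ h i) {x : Fin n → ℝ} (hx : IsVertex c h x) :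
    x ∈ box c h := by
  intro i
  rcases hx i with e | e <;> rw [e] <;> constructor <;> linarith [hh i]

/-- updating one coordinate inside its interval stays in the box. [folklore] -/
theorem update_mem_box {c h : Fin n → ℝ} {x : Fin n → ℝ} (hx : x ∈ box c h) (i : Fin n) {t : ℝ}
    (ht : t ∈ Set.Icc (c i - h i) (c i + h i)) : Function.update x i t ∈ box c h := by
  intro j
  by_cases hji : j = i
  · subst hji; simp only [Function.update_self]; exact ht
  · rw [Function.update_of_ne hji]; exact hx j

/-- **THE VERTEX INTERPOLATION LEMMA.**  If every coordinate slice `t ↦ f (update x i t)` through every point of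
the box is such that subtracting `(Mᵢ/2) t²` makes it concave, and `m ≤ f` at all vertices, then
`f x ≥ m − Σᵢ Mᵢ hᵢ² / 2` on the whole box. [folklore] -/
theorem ge_min_vertices_sub {c h M : Fin n → ℝ} (hh : ∀ i, 0 < h i) (hM : ∀ i, 0 ≤ M i) {f : (Fin n → ℝ) → ℝ}
    (hconc : ∀ x ∈ box c h, ∀ i, ConcaveOn ℝ (Set.Icc (c i - h i) (c i + h i))
      (fun t => f (Function.update x i t) - M i / 2 * t ^ 2))
    {m : ℝ} (hm : ∀ x, IsVertex c h x → m ≤ f x) {x : Fin n → ℝ} (hx : x ∈ box c h) :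
    m - ∑ i, M i * h i ^ 2 / 2 ≤ f x := by
  -- induction over the finset `F` of coordinates NOT known to be at an endpoint
  suffices key : ∀ (F : Finset (Fin n)) (y : Fin n → ℝ), y ∈ box c h →
      (∀ i, i ∉ F → (y i = c i - h i ∨ y i = c i + h i)) → m - ∑ i ∈ F, M i * h i ^ 2 / 2 ≤ f y by
    have := key Finset.univ x hx (fun i hi => absurd (Finset.mem_univ i) hi)
    simpa using this
  intro F
  induction F using Finset.induction with
  | empty =>
      intro y _ hend
      simp only [Finset.sum_empty, sub_zero]
      exact hm y fun i => hend i (Finset.notMem_empty i)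
  | @insert i F hiF ih =>
      intro y hy hend
      -- the two endpoint updates in coordinate `i`
      set a := c i - h i with ha
      set b := c i + h i with hb
      have hab : a < b := by rw [ha, hb]; linarith [hh i]
      have hya : Function.update y i a ∈ box c h := update_mem_box hy i ⟨le_rfl, hab.le⟩
      have hyb : Function.update y i b ∈ box c h := update_mem_box hy i ⟨hab.le, le_rfl⟩
      have henda : ∀ j, j ∉ F → (Function.update y i a j = c j - h j ∨ Function.update y i a j = c j + h j) := by
        intro j hj
        by_cases hji : j = i
        · subst hji; left; simp [ha]
        · rw [Function.update_of_ne hji]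
          exact hend j (fun hmem => by rcases Finset.mem_insert.mp hmem with h | h <;> [exact hji h; exact hj h])
      have hendb : ∀ j, j ∉ F → (Function.update y i b j = c j - h j ∨ Function.update y i b j = c j + h j) := by
        intro j hj
        by_cases hji : j = i
        · subst hji; right; simp [hb]
        · rw [Function.update_of_ne hji]
          exact hend j (fun hmem => by rcases Finset.mem_insert.mp hmem with h | h <;> [exact hji h; exact hj h])
      have iha := ih _ hya henda
      have ihb := ih _ hyb hendb
      -- the slice through `y` in coordinate `i`
      set g : ℝ → ℝ := fun t => f (Function.update y i t) with hg
      have hyi : y i ∈ Set.Icc a b := by rw [ha, hb]; exact ⟨(hy i).1, (hy i).2⟩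
      have h1 := ge_min_sub (g := g) hab (hM i) (hconc y hy i) hyi
      have hgy : g (y i) = f y := by rw [hg]; simp
      have hga : g a = f (Function.update y i a) := rfl
      have hgb : g b = f (Function.update y i b) := rfl
      rw [hgy, hga, hgb] at h1
      have hwid : ((b - a) / 2) ^ 2 = h i ^ 2 := by rw [ha, hb]; ring
      rw [hwid] at h1
      rw [Finset.sum_insert hiF]
      have hmin : m - ∑ j ∈ F, M j * h j ^ 2 / 2 ≤ min (f (Function.update y i a)) (f (Function.update y i b)) :=
        le_min iha ihb
      linarith

/-- Anchor of this support file (registered stub of the line skeleton, lead c2): the chord of a constant. -/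
theorem stub_certInterp : chord (fun _ => (1 : ℝ)) 0 1 (1 / 2) = 1 := by
  unfold chord; norm_num

end Summit.AtomisticToContinuum.Crystallization.Theorems.PhononStabilityCWC.Cert

end
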